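import Literature.NumberTheory.LFunctions.PageUniformPNT
import Literature.NumberTheory.LFunctions.NoExceptionalZeroUpTo
import HarnessLib

/-!
# The prime number theorem for arithmetic progressions to NON-EXCEPTIONAL moduli `q ≤ Q`,
# with constants independent of `Q` (Page–Landau; McCurley's "nonexceptional moduli")

Topic `Literature/NumberTheory/LFunctions`; namespace `Literature.NumberTheory.LFunctions`.
Everything in this file is PROVED (theorems only; no definition, no named fact).

## The statement and why it is the consumer of a no-exceptional-zero table

The Siegel–Walfisz theorem of the tree (`siegel_walfisz_holds`, Montgomery–Vaughan Cor. 11.19)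
controls `ψ(x; q, a) − x/φ(q)` uniformly for `q ≤ (log x)^A` with an INEFFECTIVE constant (Siegel);
Page's theorem (`PageUniformPNT.chebyshevPsiMod_uniform`, MV Cor. 11.17 with Cor. 11.10) is
effective but must discard the multiples of one exceptional modulus at every scale. Both defects
have a single cause: a possible real zero of a quadratic `L(s, χ)` in the window
`[1 − c₀/log q, 1]`. McCurley (J. Number Theory 19 (1984), p. 8): "Nonexceptional moduli are of
particular interest since for these `k` Theorem 1 allows us to prove sharp explicit numerical
bounds for the Chebyshev functions `ψ(x; k, l)` and `θ(x; k, l)`"; Bennett–Martin–O'Bryant–Rechnitzer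
(Illinois J. Math. 62 (2018), Prop. 6.18) make this a theorem for every modulus `q ≥ 10⁵` whose
quadratic `L`-functions have no real zero beyond `1 − 1/(R₁ log q)`, and note that Platt's
computation supplies the hypothesis for `q ≤ 4·10⁵`. This file proves the tree's (inexplicit-
constant) form of that consumer, for a whole certified range at once and with constants that do
NOT depend on the range:

* `chebyshevPsiMod_bound_of_noExceptionalZeroUpTo` — **for every `c₀ > 0` there are `k, m > 0`
  such that for every level `Q` with `NoExceptionalZeroUpTo Q c₀` (no real zero of `L(s, χ)`, `χ`
  quadratic primitive mod `3 ≤ q ≤ Q`, in `[1 − c₀/log q, 1]`; `NoExceptionalZeroUpTo.lean`), every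
  modulus `1 ≤ q ≤ Q`, every reduced class `a` mod `q` and every `x ≥ 2`:**

  `|ψ(x; q, a) − x/φ(q)| ≤ k · (q (1 + log q)⁵/φ(q)) · x · exp(−m √(log x)/(1 + log q))`.

  The constants `k, m` depend on `c₀` and on the absolute constants of the tree's zero-free region
  (`DirichletZFR.exists_norm_logDeriv_le_of_re_ge`) and of `ζ` (`classicalZFRData_riemannZeta`) —
  the quantifier order `∀ c₀, ∃ k m, ∀ Q` is the content: a larger certified table extends the
  RANGE of moduli, never the constants. (For `log q ≤ ε √log x` the error is
  `≪ x exp(−(m/2ε)… )`-small; the estimate is non-trivial as soon as `(1 + log q)⁶ = o(√log x)`.)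

Proof: exactly the proof of `PageUniformPNT.chebyshevPsiMod_uniform` (Landau's method with explicit
dependence, `ClassicalPsiData.abs_psi_sub_le_explicit`, fed by
`PageUniformPNT.exists_classicalPsiData_of_realZeros`), run at the scale `T = 1 + log q` with the
lower bound `1 − β ≥ min(c₀, 1)/T` for the real zeros of the quadratic `L(s, χ)`, `χ ≠ χ₀` mod `q`,
which the table provides (`NoExceptionalZeroUpTo.one_sub_realZero_ge`: imprimitive characters are
reduced to their primitive inducers of conductor `≤ q ≤ Q`) in place of Page's `c_P/T` outside the
exceptional modulus.

What this is NOT: not an explicit-numerical-constant estimate (McCurley 1984b / Bennett et al.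
2018 Prop. 6.18 compute `k, m`; the tree's region constants are existential), and not a statement
about `q > Q`.

## References

* K. S. McCurley, *Explicit zero-free regions for Dirichlet L-functions*, J. Number Theory 19
  (1984) 7–32, remark after Theorem 1 (p. 8). [McCurley1984ZFR]
* M. A. Bennett, G. Martin, K. O'Bryant, A. Rechnitzer, Illinois J. Math. 62 (2018) 427–532,
  Proposition 6.18 and the remark before it. [BennettMartinOBryantRechnitzer2018]
* H. L. Montgomery, R. C. Vaughan, *Multiplicative Number Theory I*, CUP 2007, Theorem 11.16 and
  Corollaries 11.17, 11.19. [MontgomeryVaughan2007]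
-/

noncomputable section

open Complex Filter Topology Metric Set Finset
open scoped LSeries.notation ArithmeticFunction.vonMangoldt

namespace Literature.NumberTheory.LFunctions

open PageUniformPNT

set_option maxHeartbeats 1600000 in
/-- **The prime number theorem for progressions to non-exceptional moduli, uniformly up to the
certified level and with level-independent constants.** For every `c₀ > 0` there are `k > 0` and
`m > 0` such that: whenever `NoExceptionalZeroUpTo Q c₀` holds, then for all `1 ≤ q ≤ Q`, all units
`a` mod `q` and all real `x ≥ 2`,
`|ψ(x; q, a) − x/φ(q)| ≤ k · (q (1 + log q)⁵ / φ(q)) · x · exp(−m √(log x) / (1 + log q))`.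
(Montgomery–Vaughan Theorem 11.16 without the exceptional term; McCurley's "nonexceptional
moduli"; Bennett–Martin–O'Bryant–Rechnitzer Prop. 6.18 in inexplicit-constant form, for all
`q ≤ Q` at once.) [cite: BennettMartinOBryantRechnitzer2018, Proposition 6.18] -/
theorem chebyshevPsiMod_bound_of_noExceptionalZeroUpTo {c₀ : ℝ} (hc₀ : 0 < c₀) :
    ∃ k m : ℝ, 0 < k ∧ 0 < m ∧ ∀ Q : ℕ, NoExceptionalZeroUpTo Q c₀ →
      ∀ q : ℕ, 1 ≤ q → q ≤ Q → ∀ (a : (ZMod q)ˣ) (x : ℝ), 2 ≤ x →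
        |Literature.NumberTheory.Sieve.ParityWave0.chebyshevPsiMod q a x - x / q.totient| ≤
          k * ((q : ℝ) * (1 + Real.log q) ^ 5 / q.totient) * x *
            Real.exp (-(m * Real.sqrt (Real.log x) / (1 + Real.log q))) := by
  obtain ⟨c₃, cζ, Cζ, C₃, hc₃, hcζ, hCζ, hC₃, hData⟩ := exists_classicalPsiData_of_realZeros
  -- the role of Page's constant `c_P` is played by `c' = min(c₀, 1)`
  set c' : ℝ := min c₀ 1 with hc'
  have hc'0 : 0 < c' := lt_min hc₀ one_pos
  -- absolute constants (given `c₀`)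
  set m₁ : ℝ := min (min (c₃ / 2) (c' / 8)) (min cζ (1 / 4)) with hm₁
  have hm₁0 : 0 < m₁ := lt_min (lt_min (by positivity) (by positivity)) (lt_min hcζ (by norm_num))
  have hm₁a : m₁ ≤ c₃ / 2 := (min_le_left _ _).trans (min_le_left _ _)
  have hm₁b : m₁ ≤ c' / 8 := (min_le_left _ _).trans (min_le_right _ _)
  have hm₁c : m₁ ≤ cζ := (min_le_right _ _).trans (min_le_left _ _)
  have hm₁d : m₁ ≤ 1 / 4 := (min_le_right _ _).trans (min_le_right _ _)
  clear_value m₁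
  set m₂ : ℝ := min (c' / 2) 1 with hm₂
  have hm₂0 : 0 < m₂ := lt_min (by positivity) one_pos
  have hm₂a : m₂ ≤ c' / 2 := min_le_left _ _
  have hm₂b : m₂ ≤ 1 := min_le_right _ _
  clear_value m₂
  set e : ℝ := Real.exp 1 with he
  have he0 : 0 < e := Real.exp_pos 1
  set k₁ : ℝ := Cζ + 3 + 64 * C₃ / m₂ with hk₁
  have hk₁0 : 0 ≤ k₁ := by rw [hk₁]; positivity
  set k₂ : ℝ := k₁ * (32 * e + 144 * Real.pi / m₁) + 1 with hk₂
  have hk₂0 : 0 ≤ k₂ := by rw [hk₂]; positivity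
  set k₃ : ℝ := 1 / 4 + 8 * k₂ + 9 * e ^ 2 with hk₃
  have hk₃0 : 0 < k₃ := by rw [hk₃]; positivity
  refine ⟨k₃, m₁ / 24, hk₃0, by positivity, fun Q hN q hq hqQ a x hx2 ↦ ?_⟩
  haveI : NeZero q := ⟨by omega⟩
  have ha : IsUnit (a : ZMod q) := Units.isUnit a
  have hx0 : 0 < x := by linarith
  have hq1 : (1 : ℝ) ≤ q := by exact_mod_cast hq
  have hq0 : (0 : ℝ) < q := by linarith
  have hlogq0 : 0 ≤ Real.log q := Real.log_nonneg hq1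
  -- the scale `T = 1 + log q`
  set T : ℝ := 1 + Real.log q with hTdef
  have hT1 : 1 ≤ T := by rw [hTdef]; linarith
  have hT0 : 0 < T := by linarith
  have hqT : Real.log q ≤ T := by rw [hTdef]; linarith
  -- the real zeros mod `q`, from the table
  have hηq : ∀ χ : DirichletCharacter ℂ q, χ ^ 2 = 1 → χ ≠ 1 → ∀ β : ℝ, χ.LFunction β = 0 →
      c' / T ≤ 1 - β := fun χ h2 h1 β hβ ↦
    hN.one_sub_realZero_ge hc₀ hqQ hT1 hqT χ (MulChar.isQuadratic_iff_sq_eq_one.mpr h2) h1 hβ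
  have hδ0 : 0 < c' / T := div_pos hc'0 hT0
  -- lower bounds for `c_q` and `d_q`
  have hcq : m₁ / T ≤ min (min (c₃ / (1 + Real.log q)) (c' / T / 8)) (min cζ (1 / 4)) := by
    have hmT : m₁ / T ≤ m₁ := div_le_self hm₁0.le hT1
    refine le_min (le_min ?_ ?_) (le_min (hmT.trans hm₁c) (hmT.trans hm₁d))
    · calc m₁ / T ≤ (c₃ / 2) / T := div_le_div_of_nonneg_right hm₁a hT0.le
        _ = c₃ / (2 * T) := by rw [div_div]
        _ ≤ c₃ / (1 + Real.log q) := div_le_div_of_nonneg_left hc₃.le (by linarith) (by linarith)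
    · calc m₁ / T ≤ (c' / 8) / T := div_le_div_of_nonneg_right hm₁b hT0.le
        _ = c' / T / 8 := by ring
  have hdq : m₂ / T ≤ min (c' / T / 2) 1 := by
    refine le_min ?_ ((div_le_self hm₂0.le hT1).trans hm₂b)
    calc m₂ / T ≤ (c' / 2) / T := div_le_div_of_nonneg_right hm₂a hT0.le
      _ = c' / T / 2 := by ring
  -- the data and Landau's explicit estimate
  have hD := hData q (a : ZMod q) ha (c' / T) hδ0 hηq
  have hPsi := hD.abs_psi_sub_le_explicit hx2
  set cq : ℝ := min (min (c₃ / (1 + Real.log q)) (c' / T / 8)) (min cζ (1 / 4)) with hcqdef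
  set dq : ℝ := min (c' / T / 2) 1 with hdqdef
  have hcq0 : 0 < cq := lt_of_lt_of_le (div_pos hm₁0 hT0) hcq
  have hcq4 : cq ≤ 1 / 4 := (min_le_right _ _).trans (min_le_right _ _)
  have hdq0 : 0 < dq := lt_of_lt_of_le (div_pos hm₂0 hT0) hdq
  have hdq1 : dq ≤ 1 := min_le_right _ _
  clear_value cq dq
  have hcq2 : cq ≤ 1 / 2 := by linarith only [hcq4]
  have hmin : min cq (1 / 2) = cq := min_eq_left hcq2
  rw [hmin] at hPsi
  revert hPsi
  clear hD
  -- bounds for the pieces of the constant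
  have hlog40 : 0 < Real.log 4 := Real.log_pos (by norm_num)
  have hℒ₀ : Real.log q + Real.log 4 ≤ 4 * T := by linarith only [hqT, log_four_le_three, hT1]
  have hℒ₀0 : 0 ≤ Real.log q + Real.log 4 := by linarith only [hlogq0, hlog40]
  have hinvd : 1 / dq ≤ T / m₂ := by
    rw [div_le_div_iff₀ hdq0 hm₂0]
    have := (div_le_iff₀ hT0).1 hdq
    linarith only [this]
  have hinvc : 1 / cq ≤ T / m₁ := by
    rw [div_le_div_iff₀ hcq0 hm₁0]
    have := (div_le_iff₀ hT0).1 hcq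
    linarith only [this]
  have hT4 : 1 ≤ T ^ 4 := one_le_pow₀ hT1
  have hT5 : 1 ≤ T ^ 5 := one_le_pow₀ hT1
  have hTT4 : T ≤ T ^ 4 := le_self_pow₀ hT1 (by norm_num)
  have hqT4 : 1 ≤ (q : ℝ) * T ^ 4 := one_le_mul_of_one_le_of_one_le hq1 hT4
  have hqT5 : 1 ≤ (q : ℝ) * T ^ 5 := one_le_mul_of_one_le_of_one_le hq1 hT5
  -- `C_q ≤ k₁ q T⁴`
  have hCq : Cζ + 3 * Real.log q + q * (C₃ * ((Real.log q + Real.log 4) ^ 3 / dq)) ≤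
      k₁ * (q * T ^ 4) := by
    have h1 : (Real.log q + Real.log 4) ^ 3 ≤ 64 * T ^ 3 := by
      calc (Real.log q + Real.log 4) ^ 3 ≤ (4 * T) ^ 3 := pow_le_pow_left₀ hℒ₀0 hℒ₀ 3
        _ = 64 * T ^ 3 := by ring
    have h2 : (Real.log q + Real.log 4) ^ 3 / dq ≤ 64 * T ^ 3 * (T / m₂) := by
      rw [div_eq_mul_one_div]
      exact mul_le_mul h1 hinvd (by positivity) (by positivity)
    have h3 : q * (C₃ * ((Real.log q + Real.log 4) ^ 3 / dq)) ≤ q * (C₃ * (64 * T ^ 3 * (T / m₂))) :=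
      mul_le_mul_of_nonneg_left (mul_le_mul_of_nonneg_left h2 hC₃) hq0.le
    have h4 : q * (C₃ * (64 * T ^ 3 * (T / m₂))) = 64 * C₃ / m₂ * (q * T ^ 4) := by
      field_simp
    have h5 : Cζ ≤ Cζ * (q * T ^ 4) := le_mul_of_one_le_right hCζ hqT4
    have h6 : 3 * Real.log q ≤ 3 * (q * T ^ 4) := by
      have : Real.log q ≤ q * T ^ 4 := by
        calc Real.log q ≤ T := hqT
          _ ≤ T ^ 4 := hTT4
          _ = 1 * T ^ 4 := (one_mul _).symm
          _ ≤ q * T ^ 4 := mul_le_mul_of_nonneg_right hq1 (by positivity)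
      linarith only [this]
    have eq : k₁ * (q * T ^ 4) = Cζ * (q * T ^ 4) + 3 * (q * T ^ 4) + 64 * C₃ / m₂ * (q * T ^ 4) := by
      rw [hk₁]; ring
    linarith only [h3, h4, h5, h6, eq]
  -- `C_q (32e + 12π/(c_q/12)) + 1 ≤ k₂ q T⁵`
  have hTk : (Cζ + 3 * Real.log q + q * (C₃ * ((Real.log q + Real.log 4) ^ 3 / dq))) *
      (32 * Real.exp 1 + 12 * Real.pi / (cq / 12)) + 1 ≤ k₂ * (q * T ^ 5) := by
    have hπ : 0 < Real.pi := Real.pi_pos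
    have h1 : 12 * Real.pi / (cq / 12) = 144 * Real.pi * (1 / cq) := by field_simp; ring
    have h2 : 12 * Real.pi / (cq / 12) ≤ 144 * Real.pi / m₁ * T := by
      rw [h1]
      calc 144 * Real.pi * (1 / cq) ≤ 144 * Real.pi * (T / m₁) :=
            mul_le_mul_of_nonneg_left hinvc (by positivity)
        _ = 144 * Real.pi / m₁ * T := by ring
    have h3 : 32 * Real.exp 1 + 12 * Real.pi / (cq / 12) ≤ (32 * e + 144 * Real.pi / m₁) * T := by
      rw [← he, add_mul]
      have : 32 * e ≤ 32 * e * T := le_mul_of_one_le_right (by positivity) hT1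
      linarith only [h2, this]
    have hCq0 : 0 ≤ Cζ + 3 * Real.log q + q * (C₃ * ((Real.log q + Real.log 4) ^ 3 / dq)) := by
      positivity
    have h32 : 0 ≤ 32 * Real.exp 1 + 12 * Real.pi / (cq / 12) := by positivity
    have hk₁U : 0 ≤ k₁ * (q * T ^ 4) := by positivity
    have h4 := mul_le_mul hCq h3 h32 hk₁U
    have h5 : k₁ * (q * T ^ 4) * ((32 * e + 144 * Real.pi / m₁) * T) =
        k₁ * (32 * e + 144 * Real.pi / m₁) * (q * T ^ 5) := by ring
    have e2 : k₂ * (q * T ^ 5) = k₁ * (32 * e + 144 * Real.pi / m₁) * (q * T ^ 5) + q * T ^ 5 := by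
      rw [hk₂]; ring
    linarith only [h4, h5, hqT5, e2]
  -- `ψ_Λ(6) ≤ 12 q`
  have hψ6 := SiegelWalfisz.psi_residue_six_le q (a : ZMod q)
  have hφq : (q.totient : ℝ) ≤ q := by exact_mod_cast Nat.totient_le q
  have hφ1 : (1 : ℝ) ≤ q.totient := by exact_mod_cast Nat.totient_pos.2 (NeZero.pos q)
  -- the full constant `K_q ≤ k₃ q T⁵`
  have hK : (1 / 4 + 8 * ((Cζ + 3 * Real.log q + q * (C₃ * ((Real.log q + Real.log 4) ^ 3 / dq))) *
      (32 * Real.exp 1 + 12 * Real.pi / (cq / 12)) + 1)) +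
      (ClassicalPsiData.psi (fun n ↦ (q.totient : ℝ) * ArithmeticFunction.vonMangoldt.residueClass
        (a : ZMod q) n) 6 + 6) * (Real.exp 2 / 2) ≤ k₃ * (q * T ^ 5) := by
    have h1 : Real.exp 2 = e ^ 2 := by rw [he, ← Real.exp_nat_mul]; norm_num
    have hqq : (q : ℝ) ≤ q * T ^ 5 := le_mul_of_one_le_right hq0.le hT5
    have h2 : (ClassicalPsiData.psi (fun n ↦ (q.totient : ℝ) *
        ArithmeticFunction.vonMangoldt.residueClass (a : ZMod q) n) 6 + 6) * (Real.exp 2 / 2) ≤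
        9 * e ^ 2 * (q * T ^ 5) := by
      rw [h1]
      have h18 : ClassicalPsiData.psi (fun n ↦ (q.totient : ℝ) *
          ArithmeticFunction.vonMangoldt.residueClass (a : ZMod q) n) 6 + 6 ≤ 18 * (q * T ^ 5) := by
        linarith only [hψ6, hφq, hqq, hqT5]
      have he2 : 0 ≤ e ^ 2 / 2 := by positivity
      calc (ClassicalPsiData.psi (fun n ↦ (q.totient : ℝ) *
            ArithmeticFunction.vonMangoldt.residueClass (a : ZMod q) n) 6 + 6) * (e ^ 2 / 2)
          ≤ 18 * (q * T ^ 5) * (e ^ 2 / 2) := mul_le_mul_of_nonneg_right h18 he2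
        _ = 9 * e ^ 2 * (q * T ^ 5) := by ring
    have e3 : k₃ * (q * T ^ 5) = 1 / 4 * (q * T ^ 5) + 8 * (k₂ * (q * T ^ 5)) + 9 * e ^ 2 * (q * T ^ 5) := by
      rw [hk₃]; ring
    linarith only [hTk, h2, hqT5, e3]
  -- the exponential factor: `c_q ≥ m₁/T`
  have hexp : Real.exp (-(cq / 12 / 2) * Real.sqrt (Real.log x)) ≤
      Real.exp (-(m₁ / 24 * Real.sqrt (Real.log x) / (1 + Real.log q))) := by
    rw [Real.exp_le_exp, ← hTdef]
    have hs0 : 0 ≤ Real.sqrt (Real.log x) := Real.sqrt_nonneg _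
    have h1 : m₁ / T * Real.sqrt (Real.log x) ≤ cq * Real.sqrt (Real.log x) :=
      mul_le_mul_of_nonneg_right ((div_le_iff₀ hT0).2 ((div_le_iff₀ hT0).1 hcq)) hs0
    have e4 : -(cq / 12 / 2) * Real.sqrt (Real.log x) = -(cq * Real.sqrt (Real.log x)) / 24 := by ring
    have e5 : -(m₁ / 24 * Real.sqrt (Real.log x) / T) = -(m₁ / T * Real.sqrt (Real.log x)) / 24 := by
      ring
    rw [e4, e5]
    linarith only [h1]
  -- assemble: `|φ(q)ψ(x;q,a) − x| ≤ k₃ q T⁵ x e^{−(m₁/24)√(log x)/T}`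
  intro hPsi
  have hmain : |(q.totient : ℝ) * Literature.NumberTheory.Sieve.ParityWave0.chebyshevPsiMod q a x - x| ≤
      k₃ * (q * T ^ 5) * x * Real.exp (-(m₁ / 24 * Real.sqrt (Real.log x) / (1 + Real.log q))) := by
    rw [← SiegelWalfisz.psi_residue_eq]
    refine hPsi.trans ?_
    have hKnn : 0 ≤ k₃ * (q * T ^ 5) := by positivity
    exact mul_le_mul (mul_le_mul_of_nonneg_right hK hx0.le) hexp (Real.exp_pos _).le
      (mul_nonneg hKnn hx0.le)
  -- conclude: divide by `φ(q)`
  have hφ0 : (0 : ℝ) < q.totient := by linarith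
  have hdiv : |Literature.NumberTheory.Sieve.ParityWave0.chebyshevPsiMod q a x - x / q.totient| =
      |(q.totient : ℝ) * Literature.NumberTheory.Sieve.ParityWave0.chebyshevPsiMod q a x - x| /
        q.totient := by
    rw [← abs_of_pos hφ0, ← abs_div, abs_of_pos hφ0]
    congr 1
    field_simp
  rw [hdiv, div_le_iff₀ hφ0]
  calc |(q.totient : ℝ) * Literature.NumberTheory.Sieve.ParityWave0.chebyshevPsiMod q a x - x|
      ≤ k₃ * (q * T ^ 5) * x * Real.exp (-(m₁ / 24 * Real.sqrt (Real.log x) / (1 + Real.log q))) :=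
        hmain
    _ = k₃ * ((q : ℝ) * (1 + Real.log q) ^ 5 / q.totient) * x *
          Real.exp (-(m₁ / 24 * Real.sqrt (Real.log x) / (1 + Real.log q))) * q.totient := by
        rw [hTdef]; field_simp

end Literature.NumberTheory.LFunctions

end
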